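import Summits.AtomisticToContinuum.HydrodynamicLimit.Theorems.LambertianContactSwapLambertianEulerIterate
import Summits.AtomisticToContinuum.HydrodynamicLimit.Theorems.LambertianContactSwapLambertianEulerWindow
import Summits.AtomisticToContinuum.HydrodynamicLimit.Theorems.LambertianContactSwapLambertianEulerMarkov
import HarnessLib

/-!
# `SwapGap` (stmt-AtomisticToContinuum-11850), line `Sketch`: the registered stub S0 `stub_liouvilleInvarianceLambda`

Helper file (`--supports`) closing the registered stub S0 of the skeleton `Cruxes/SwapGap/Lines/Sketch.lean`
(sha 92687f7f): the `Λ`-INVARIANCE OF `liouville ⊗ γ^ℕ` on `𝕋³` — for `0 < ε < 1/2`, every `N` and every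
`t ≥ 0`, `(liouville ⊗ γ^ℕ) ∘ Λ_t⁻¹ = liouville`, `Λ_t = lambertFlow (Torus.geometry (Fin 3)) ε` the Lambertian
(cosine-law) hard-sphere flow and `γ^ℕ = lambertNoise (Fin 3)` its i.i.d. Gaussian redraw noise.

S0 is verbatim the stub `stub_liouvilleInvariance` of the sibling crux `LambertianContactSwap.LambertianEuler`
(stmt-AtomisticToContinuum-11854), to whose line it was delegated; that line has LANDED its three pieces —
WINDOW (`…LambertianEulerWindow.stub_windowLambda`, p112254: one-window annealed sub-invariance on the
short-time good set), MARKOV (`…LambertianEulerMarkov.stub_markovLambda`, p110886: restricted fresh-tail identity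
at checkpoint events) and ITERATE (`…LambertianEulerIterate.stub_iterateLambda`, p113149: GST iteration with
fresh noise, WINDOW → MARKOV → invariance for all `t ≥ 0` and a.e. non-accumulation) — so S0 is now the
three-line composition below, and with it every result of `…SwapGapRelEntBudget` / `…SwapGapRelEntSwapSplit` /
`…SwapGapStubRelEntDecomposition` (exact decomposition of `KL(p_t ‖ q_t)`, `O(N)` budget, echo form) becomes
unconditional.  Also recorded: a.e. non-accumulation of the Lambertian collision instants under
`liouville ⊗ γ^ℕ` (`nonAccumulationLambda`).  prover-line-stmt-AtomisticToContinuum-11850-c2-0 (lead c2, cycle 3).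
-/

noncomputable section

open MeasureTheory
open scoped ENNReal

namespace Summit.AtomisticToContinuum.HydrodynamicLimit.Theorems.LambertianContactSwapSwapGapLiouvilleInvarianceLambda

open Literature.Analysis.FluidPDE Literature.MathematicalPhysics.KineticTheory
open Summit.AtomisticToContinuum.HydrodynamicLimit.Theorems
open Summit.AtomisticToContinuum.HydrodynamicLimit.Theorems.LambertianContactSwapLambertianEulerWindow
open Summit.AtomisticToContinuum.HydrodynamicLimit.Theorems.LambertianContactSwapLambertianEulerMarkov
open Summit.AtomisticToContinuum.HydrodynamicLimit.Theorems.LambertianContactSwapLambertianEulerIterate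

/-- **Registered stub S0 `stub_liouvilleInvarianceLambda` of line `Sketch`** (crux stmt-AtomisticToContinuum-11850;
verbatim `stub_liouvilleInvariance` of crux stmt-AtomisticToContinuum-11854): for `0 < ε < 1/2`, every `N` and
`t ≥ 0`, the annealed Lambertian flow preserves the Liouville measure of the hard-sphere domain on `𝕋³`,
`((liouville ⊗ γ^ℕ)).map (p ↦ Λ_t(p.1; p.2)) = liouville`.  WINDOW + MARKOV fed into ITERATE, first conjunct.
[cite: GST2013, Prop. 4.1.1; CometsEtAl2008, Thm 2.4] -/
theorem stub_liouvilleInvarianceLambda :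
    ∀ ε : ℝ, 0 < ε → ε < 2⁻¹ → ∀ (N : ℕ) (t : ℝ), 0 ≤ t →
      ((liouville (Torus.geometry (Fin 3)) N ε).prod (lambertNoise (Fin 3))).map
          (fun p => lambertFlow (Torus.geometry (Fin 3)) ε p.2 p.1 t) =
        liouville (Torus.geometry (Fin 3)) N ε :=
  fun _ hε hε' _ t ht =>
    (stub_iterateLambda hε hε' (fun hV hδ hr hch => stub_windowLambda hε hV hδ hr hch)
      (fun z s hs _ r hr _ hQ _ hH => stub_markovLambda hε hε' z s hs r hr hQ hH)).1 t ht

/-- **A.e. non-accumulation of the Lambertian collision instants** (the almost-sure well-posedness half of the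
`Λ`-Liouville theorem): for `0 < ε < 1/2` and every `N`, for `liouville ⊗ γ^ℕ`-a.e. `(z, ξs)` the collision instants
`lambertInstant … ξs z k` exceed every `T`.  ITERATE, second conjunct. [cite: GST2013, Prop. 4.1.1] -/
theorem nonAccumulationLambda :
    ∀ ε : ℝ, 0 < ε → ε < 2⁻¹ → ∀ N : ℕ,
      ∀ᵐ p ∂((liouville (Torus.geometry (Fin 3)) N ε).prod (lambertNoise (Fin 3))),
        ∀ T : ℝ, ∃ k, ENNReal.ofReal T < lambertInstant (Torus.geometry (Fin 3)) ε p.2 p.1 k :=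
  fun _ hε hε' _ =>
    (stub_iterateLambda hε hε' (fun hV hδ hr hch => stub_windowLambda hε hV hδ hr hch)
      (fun z s hs _ r hr _ hQ _ hH => stub_markovLambda hε hε' z s hs r hr hQ hH)).2

end Summit.AtomisticToContinuum.HydrodynamicLimit.Theorems.LambertianContactSwapSwapGapLiouvilleInvarianceLambda

end
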